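import Literature.AlgebraicGeometry.AbelianSchemes.AbelianSchemeQuotientHatIsDualIsogeny
import Literature.AlgebraicGeometry.AbelianSchemes.AbelianSchemeDualIsogenyComp
import Literature.AlgebraicGeometry.AbelianSchemes.AbelianSchemeQuotientHomDescent
import HarnessLib

/-!
# The Hecke-link polarisation identity `ψ ≫ λ_B ≫ ψ^∨ = λ ≫ [n]^∨` for the quotient `B = A/K` (HECKE-LINK H2c, export (b))

Layer `Literature/AlgebraicGeometry/AbelianSchemes`, namespace `Literature.AlgebraicGeometry.AbelianSchemes.AbelianSchemeOver`.
Cell `hodgecm-mathlib`, HECKE-LINK line card v1.2 §1.  COMPANION of ★ `AbelianSchemeQuotientPolarizationPullback` (p747941, B-p14 (g14):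
the same identity in `.left` form with the composition law `hcomp` and `[n]^∨ = [n]` as hypotheses); here `hcomp` is DISCHARGED by ★
`dualIsogeny_comp` (p747478) and the statement is in `Over S` form — the export (b) that B-p11 (g13)'s (T3b) engine, B-p04 (g17)'s (γ) composition
and B-p14 (g14)'s (β) glue take as a binder, ASSEMBLED from ★ `quotientMk_comp_polarizationDesc` (p746532: `ψ ≫ λ_B = λ ≫ ψ̂`), ★
`quotientMk_eq_dualIsogenyOver_mulNDesc` (p747383: `ψ̂ = π^∨`), ★ `dualIsogenyOver_comp` (p747478: `π^∨ ≫ ψ^∨ = (ψ ≫ π)^∨`) and ★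
`quotientMk_comp_mulNDesc` (p742656: `ψ ≫ π = [n]`).  [MumfordAV1970] §15 Thm. 1 (p. 143), §23 (p. 231).
* `dualIsogenyOver_congr` — the dual homomorphism (Over form) depends only on the morphism (`IsMonHom` is a `Prop`; the `.left`
  form is ★ `DualPair.dualIsogeny_congr` of `AbelianSchemeQuotientPolarizationPullback`, p747941);
* **`comp_polarizationDesc_comp_dualIsogenyOver`**: `ψ ≫ λ_B ≫ ψ^∨ = λ ≫ ([n]_A)^∨` UNCONDITIONALLY, where `λ_B := polarizationDesc`
  for the dual-side subgroup `K′` and `ψ^∨` is the dual of `ψ` for the dual pairs `D` of `A` and `dualPairOfQuotientRigidified … Φ h4`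
  of `B`;
* **`comp_polarizationDesc_comp_dualIsogenyOver_of_dualIsogeny_mulN`**: the printed form `ψ ≫ λ_B ≫ ψ^∨ = λ ≫ [n]_{Â}` from the one
  remaining input «`[n]^∨ = [n]`» (`hn : dualIsogenyOver (A.mulN n) D D = D.hat.mulN n`; the (SYM-n)/(P-⊗) road, B-p05 (g15)).
THEOREMS ONLY; no definition, no instance, no sorry.  HC_CM is proved only modulo the 7 printed citations until rung 0 closes.

## References
* [MumfordAV1970] D. Mumford, *Abelian Varieties* (1970), §15 Thm. 1 (p. 143), §23 (p. 231).
* [MilneAV2008] J. S. Milne, *Abelian Varieties* (2008), I §9 (p. 42).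
-/

noncomputable section

universe u

open CategoryTheory CategoryTheory.Limits AlgebraicGeometry MonoidalCategory CartesianMonoidalCategory
open scoped MonObj

namespace Literature.AlgebraicGeometry.AbelianSchemes

namespace AbelianSchemeOver

/-! ## §1 The dual homomorphism depends only on the morphism -/

namespace DualPair

variable {S : Scheme.{u}} {A' B : AbelianSchemeOver S} (D' : A'.DualPair) (DB : B.DualPair)

/-- `dualIsogenyOver` depends only on the underlying morphism. [cite: MilneAV2008, I §9 Thm. 9.1 (p. 42)] -/
theorem dualIsogenyOver_congr {ψ₁ ψ₂ : A'.X ⟶ B.X} {h₁ : IsMonHom ψ₁} {h₂ : IsMonHom ψ₂} (h : ψ₁ = ψ₂) :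
    @dualIsogenyOver S A' B ψ₁ h₁ D' DB = @dualIsogenyOver S A' B ψ₂ h₂ D' DB := by
  subst h
  rfl

end DualPair

/-! ## §2 The identity for `B = A/K` -/

open Literature.AlgebraicGeometry.RelativeSpec Literature.AlgebraicGeometry.AbelianVarieties
  Literature.AlgebraicGeometry.Motives Literature.AlgebraicGeometry.Modules

variable {S : Scheme.{u}} (A : AbelianSchemeOver S)
  {Y : Scheme.{u}} (u : S ⟶ Y) (K : Subgroup A.Sections) [IsCommMonObj A.X] {n : ℕ}
  (hK : ∀ σ : K, (σ : A.Sections) ^ n = 1)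
  [Finite K] [Y.IsSeparated] [IsSeparated (A.X.hom ≫ u)] [S.IsSeparated]
  (hcov : ∀ x : A.left, ∃ O : (A.translationActionOver u K).StableAffineOpens, x ∈ O.1)
  [LocallyOfFiniteType (A.X.hom ≫ u)] [IsLocallyNoetherian Y]
  (hG : ∃ _ : GrpObj (A.quotientOver u K), IsMonHom (A.quotientMk u K hcov))
  (hsm : Smooth (A.quotientOver u K).hom) (hgc : GeometricallyConnected (A.quotientOver u K).hom)
  (D : A.DualPair) [IsAffine Y]
  (hfree : ∀ (Ω : Type u) [Field Ω] [IsAlgClosed Ω] (x : Spec (.of Ω) ⟶ A.left) (σ : K), σ ≠ 1 →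
    x ≫ (A.translation (σ : A.Sections)).left ≠ x)
  (K' : Subgroup D.hat.Sections) [Finite K'] [IsSeparated (D.hat.X.hom ≫ u)]
  (hcov' : ∀ x : D.hat.left, ∃ O : (D.hat.translationActionOver u K').StableAffineOpens, x ∈ O.1)
  [LocallyOfFiniteType (D.hat.X.hom ≫ u)]
  (hG' : ∃ _ : GrpObj (D.hat.quotientOver u K'), IsMonHom (D.hat.quotientMk u K' hcov'))
  (hsm' : Smooth (D.hat.quotientOver u K').hom) (hgc' : GeometricallyConnected (D.hat.quotientOver u K').hom)
  (hfree' : ∀ (Ω : Type u) [Field Ω] [IsAlgClosed Ω] (x : Spec (.of Ω) ⟶ D.hat.left) (σ : K'), σ ≠ 1 →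
    x ≫ (D.hat.translation (σ : D.hat.Sections)).left ≠ x)
  (Φ : (prodTranslationActionOver (A.quotientBy u K hcov hG hsm hgc) D.hat u K' hcov').EquivariantStructure
    (A.poincarePullback u K hK hcov hG hsm hgc D hfree))
  (lam : A.X ⟶ D.hat.X)
  (hlam : ∀ σ : K, A.translation (σ : A.Sections) ≫ lam ≫ D.hat.quotientMk u K' hcov' = lam ≫ D.hat.quotientMk u K' hcov')

/-- **`ψ ≫ λ_B ≫ ψ^∨ = λ ≫ ([n]_A)^∨`** for `B = A/K`, `λ_B := polarizationDesc`, `ψ^∨` the dual of `ψ` w.r.t. `D` and the dual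
pair `dualPairOfQuotientRigidified … Φ h4` of `B`: `ψ ≫ λ_B = λ ≫ ψ̂`, `ψ̂ = π^∨`, `π^∨ ≫ ψ^∨ = (ψ ≫ π)^∨`, `ψ ≫ π = [n]`.
[cite: MumfordAV1970, §15 Thm. 1 (p. 143)] [cite: MumfordAV1970, §23 (p. 231)] -/
theorem comp_polarizationDesc_comp_dualIsogenyOver (h4) :
    (A.quotientMk u K hcov : A.X ⟶ (A.quotientBy u K hcov hG hsm hgc).X) ≫
        A.polarizationDesc u K hcov D.hat K' hcov' lam hlam ≫
          @DualPair.dualIsogenyOver S A (A.quotientBy u K hcov hG hsm hgc) (A.quotientMk u K hcov)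
            (A.isMonHom_quotientMk u K hcov hG hsm hgc) D
            (A.dualPairOfQuotientRigidified u K hK hcov hG hsm hgc D hfree K' hcov' hG' hsm' hgc' hfree' Φ h4) =
      lam ≫ @DualPair.dualIsogenyOver S A A (A.mulN n) (A.isMonHom_mulN n) D D := by
  -- `ψ ≫ λ_B = λ ≫ ψ̂`
  have h1 := A.quotientMk_comp_polarizationDesc u K hcov D.hat K' hcov' lam hlam
  -- `ψ̂ = π^∨`
  have h2 := A.quotientMk_eq_dualIsogenyOver_mulNDesc u K hK hcov hG hsm hgc D hfree K' hcov' hG' hsm' hgc' hfree' Φ h4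
  -- `π^∨ ≫ ψ^∨ = (ψ ≫ π)^∨ = [n]^∨`
  have h3 := @DualPair.dualIsogenyOver_comp S A (A.quotientBy u K hcov hG hsm hgc) A (A.quotientMk u K hcov)
    (A.mulNDesc u K hK hcov) (A.isMonHom_quotientMk u K hcov hG hsm hgc) (A.isMonHom_mulNDesc u K hK hcov hG hsm hgc hfree)
    D (A.dualPairOfQuotientRigidified u K hK hcov hG hsm hgc D hfree K' hcov' hG' hsm' hgc' hfree' Φ h4) D
  dsimp only at h2
  rw [← Category.assoc, h1, Category.assoc, h2]
  erw [← h3]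
  congr 1
  exact DualPair.dualIsogenyOver_congr D D (A.quotientMk_comp_mulNDesc u K hK hcov)

include hfree' in
/-- **Export (b) in printed form: `ψ ≫ λ_B ≫ ψ^∨ = λ ≫ [n]_{Â}`**, from the one remaining input «`([n]_A)^∨ = [n]_{Â}`»
(`hn`; the (SYM-n)/(P-⊗) road). [cite: MumfordAV1970, §15 Thm. 1 (p. 143)] [cite: MumfordAV1970, §23 (p. 231)] -/
theorem comp_polarizationDesc_comp_dualIsogenyOver_of_dualIsogeny_mulN (h4)
    (hn : @DualPair.dualIsogenyOver S A A (A.mulN n) (A.isMonHom_mulN n) D D = D.hat.mulN n) :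
    (A.quotientMk u K hcov : A.X ⟶ (A.quotientBy u K hcov hG hsm hgc).X) ≫
        A.polarizationDesc u K hcov D.hat K' hcov' lam hlam ≫
          @DualPair.dualIsogenyOver S A (A.quotientBy u K hcov hG hsm hgc) (A.quotientMk u K hcov)
            (A.isMonHom_quotientMk u K hcov hG hsm hgc) D
            (A.dualPairOfQuotientRigidified u K hK hcov hG hsm hgc D hfree K' hcov' hG' hsm' hgc' hfree' Φ h4) =
      lam ≫ D.hat.mulN n := by
  rw [A.comp_polarizationDesc_comp_dualIsogenyOver u K hK hcov hG hsm hgc D hfree K' hcov' hG' hsm' hgc' hfree' Φ lam hlam h4,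
    hn]

end AbelianSchemeOver

end Literature.AlgebraicGeometry.AbelianSchemes

end
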